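import Summits.CriticalPhenomena.PercolationContinuityZ3.Theorems.PercNearOneGluingNoHeavyLowerTailSunflowerTBernFinal
import HarnessLib

/-!
# `NoHeavyLowerTail` (crux stmt-CriticalPhenomena-4575), abstract sunflower cubic: (RES0′) ∀n WITH THE LEAF-LEAF CONSTANT —
# monotonicity of (RES0′) in the additive constant `c₀`, and the degenerate floor `α₀₀ = 0`

Support file (seat `prim-ineq-prove-1` gen 66; `--supports stmt-CriticalPhenomena-4575`).  No `sorry`, no named facts.
Memo: run/shared/lean/prim/prim-ineq-prove-1/FINDING-RLA-prove1-g66.md §1.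

`res0_all` (`…SunflowerTBernFinal`, gen 65) proves the two-linked-systems inequality (RES0′)
`∏_S (c₀ + τ(1−σ)Ȳ_j + s(1−τ)H_j) ≤ (c₀ + τ(1−σ)b_Ȳ + s(1−τ)b_H)^(|S|−1)·(c₀ + τ(1−σ) + s(1−τ))` for every number of
petals with the constant `c₀ = τσ + (1−τ)(1−s)α₀₀`, i.e. for the block `(z₁,u,w)` whose two frozen `z₁ = 0, w = 0` cells
BOTH have the value `α₀₀`.  In the section relaxation of the relative Lemma A `RLA(A ∪ [z₁u], A ∪ [z₁] ∪ [w])` (the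
`z₂`-slice of the leaf-leaf lemma, memo FINDING-COEFFWISE-prove1-g51.md §5) the frozen cell `(z₁,u,w) = (0,1,0)` has the
value `α₁₀ = μ(A | u open, w closed) ≥ α₀₀`, so the true constant is the LEAF-LEAF CONSTANT
`c₀ = τσ + (1−τ)(1−s)((1−σ)α₀₀ + σα₁₀)` (memo FINDING-TWOLINKED-prove1-g52.md §0, §2 (F2)).  Gen 52 left "monotonicity of
(RES0′) in `c₀` for `n ≥ 3`" open.  It is elementary in normalised form: with `C = c₀ + E*`, excesses `e_j = E_j − E* ≥ 0`
and `Δ = E_full − E*`, the defect `D(C) := ∏(C + e_j)/C^(n−1) − C = σ₁ + σ₂/C + … + σ_n/C^(n−1)` is ANTITONE in `C > 0`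
(inductively `D_{t ∪ {a}} = D_t + e_a + e_a·D_t/C`), and (RES0′) reads `D(C) ≤ Δ`.
* `cDefect_insert`, `cDefect_nonneg`, `cDefect_antitone` — the defect `D_t(C)` and its monotonicity;
* `prod_shift_le` — `∏(C+e_j) ≤ C^(n−1)(C+Δ)` and `0 < C ≤ C'` give `∏(C'+e_j) ≤ C'^(n−1)(C'+Δ)`;
* `res0_of_cappedPendant₀` — `res0_of_cappedPendant` with the positivity hypothesis weakened to `0 ≤ α₀₀`, `0 < b_Ȳ`
  (`b_Ȳ = (1−s)α₀₀ + sα₀₁`, the floor actually used by the capped pendant lemma);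
* `res0_shift` — (RES0′) ∀n with the constant `c₀ + δ` for every `δ ≥ 0`, floors `0 ≤ α₀₀ ≤ α₀₁ ≤ α₁₁`, `0 < b_Ȳ`;
* **`res0_leafLeaf`** — (RES0′) ∀n with the leaf-leaf constant (`α₀₀ ≤ α₁₀`), the analytic input of the set-level relative
  Lemma A (`…SunflowerRelativeLemmaA`).
-/

noncomputable section

namespace Summit.CriticalPhenomena.PercolationContinuityZ3.Theorems.SunflowerPartition

namespace SafeCalc

namespace LinkedCurrency

open Finset

variable {κ : Type*}

/-! ## The constant-shift defect -/

/-! The constant-shift DEFECT of a family of excesses `e` on `t` at the constant `C` is the quantity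
`D_t(C) := ∏_{j∈t}(C + e_j)/C^(|t|−1) − C` (written out in every statement below; no definition is introduced). -/

/-- The product in terms of the defect: `∏(C+e_j) = C^(|t|−1)·(D_t(C) + C)` (`C ≠ 0`). [this work] -/
theorem prod_eq_pow_mul_cDefect (t : Finset κ) (e : κ → ℝ) {C : ℝ} (hC : C ≠ 0) :
    ∏ j ∈ t, (C + e j) = C ^ (t.card - 1) * (((∏ j ∈ t, (C + e j)) / C ^ ((t).card - 1) - C) + C) := by
  have hpow : C ^ (t.card - 1) ≠ 0 := pow_ne_zero _ hC
  field_simp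
  ring

/-- On a singleton the defect is the excess itself. [this work] -/
theorem cDefect_singleton (a : κ) (e : κ → ℝ) (C : ℝ) :
    (∏ j ∈ ({a} : Finset κ), (C + e j)) / C ^ (({a} : Finset κ).card - 1) - C = e a := by
  simp

/-- Inserting a petal: `D_{t ∪ {a}}(C) = D_t(C) + e_a + e_a·D_t(C)/C` (`C ≠ 0`, `t` nonempty). [this work] -/
theorem cDefect_insert [DecidableEq κ] {t : Finset κ} {a : κ} (ha : a ∉ t) (ht : t.Nonempty) (e : κ → ℝ) {C : ℝ}
    (hC : C ≠ 0) :
    ((∏ j ∈ insert a t, (C + e j)) / C ^ ((insert a t).card - 1) - C) =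
      ((∏ j ∈ t, (C + e j)) / C ^ ((t).card - 1) - C) + e a + e a * ((∏ j ∈ t, (C + e j)) / C ^ ((t).card - 1) - C) / C := by
  have hcard : (insert a t).card - 1 = t.card := by rw [card_insert_of_notMem ha]; simp
  have hcard' : t.card = t.card - 1 + 1 := (Nat.sub_add_cancel (card_pos.2 ht)).symm
  rw [prod_insert ha, hcard]
  conv_lhs => rw [hcard', pow_succ]
  have hpow : C ^ (t.card - 1) ≠ 0 := pow_ne_zero _ hC
  field_simp
  ring

/-- The defect is nonnegative for nonnegative excesses (`C > 0`, `t` nonempty). [this work] -/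
theorem cDefect_nonneg {t : Finset κ} (ht : t.Nonempty) {e : κ → ℝ} (he : ∀ j ∈ t, 0 ≤ e j) {C : ℝ} (hC : 0 < C) :
    0 ≤ ((∏ j ∈ t, (C + e j)) / C ^ ((t).card - 1) - C) := by
  have hcard : t.card = t.card - 1 + 1 := (Nat.sub_add_cancel (card_pos.2 ht)).symm
  have h1 : C ^ t.card ≤ ∏ j ∈ t, (C + e j) := by
    rw [← prod_const]
    exact prod_le_prod (fun _ _ => hC.le) fun j hj => le_add_of_nonneg_right (he j hj)
  rw [sub_nonneg, le_div_iff₀ (pow_pos hC _)]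
  calc C * C ^ (t.card - 1) = C ^ t.card := by conv_rhs => rw [hcard, pow_succ]; ring
    _ ≤ _ := h1

/-- **The defect is antitone in the constant**: `0 < C ≤ C'` gives `D_t(C') ≤ D_t(C)` (nonnegative excesses, `t` nonempty).
[this work] -/
theorem cDefect_antitone [DecidableEq κ] (t : Finset κ) (ht : t.Nonempty) {e : κ → ℝ} (he : ∀ j ∈ t, 0 ≤ e j) {C C' : ℝ}
    (hC : 0 < C) (hCC' : C ≤ C') :
    ((∏ j ∈ t, (C' + e j)) / C' ^ ((t).card - 1) - C') ≤ ((∏ j ∈ t, (C + e j)) / C ^ ((t).card - 1) - C) := by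
  classical
  induction t using Finset.induction_on with
  | empty => exact absurd ht (by simp)
  | @insert a t ha ih =>
    rcases t.eq_empty_or_nonempty with rfl | htne
    · simp
    · have hC' : 0 < C' := hC.trans_le hCC'
      have he' : ∀ j ∈ t, 0 ≤ e j := fun j hj => he j (mem_insert_of_mem hj)
      have hea : 0 ≤ e a := he a (mem_insert_self a t)
      have ih' := ih htne he'
      have hD0 : 0 ≤ ((∏ j ∈ t, (C' + e j)) / C' ^ ((t).card - 1) - C') := cDefect_nonneg htne he' hC'
      rw [cDefect_insert ha htne e hC.ne', cDefect_insert ha htne e hC'.ne']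
      have h1 : e a * ((∏ j ∈ t, (C' + e j)) / C' ^ ((t).card - 1) - C') / C' ≤
          e a * ((∏ j ∈ t, (C + e j)) / C ^ ((t).card - 1) - C) / C := by
        rw [div_le_div_iff₀ hC' hC]
        have := mul_le_mul ih' hCC' hC.le (hD0.trans ih')
        nlinarith [mul_nonneg hea hD0, mul_nonneg hea (hD0.trans ih')]
      linarith

/-- **(RES0′)-type inequalities are monotone in the additive constant.**  If `∏_{t}(C + e_j) ≤ C^(|t|−1)·(C + Δ)` with
`e_j ≥ 0`, `0 < C ≤ C'`, then `∏_{t}(C' + e_j) ≤ C'^(|t|−1)·(C' + Δ)`. [this work] -/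
theorem prod_shift_le [DecidableEq κ] {t : Finset κ} (ht : t.Nonempty) {e : κ → ℝ} (he : ∀ j ∈ t, 0 ≤ e j) {C C' Δ : ℝ}
    (hC : 0 < C) (hCC' : C ≤ C') (h : ∏ j ∈ t, (C + e j) ≤ C ^ (t.card - 1) * (C + Δ)) :
    ∏ j ∈ t, (C' + e j) ≤ C' ^ (t.card - 1) * (C' + Δ) := by
  have hC' : 0 < C' := hC.trans_le hCC'
  have hD : ((∏ j ∈ t, (C + e j)) / C ^ ((t).card - 1) - C) ≤ Δ := by
    rw [prod_eq_pow_mul_cDefect t e hC.ne'] at h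
    have h' := le_of_mul_le_mul_left h (pow_pos hC _)
    linarith
  have hD' : ((∏ j ∈ t, (C' + e j)) / C' ^ ((t).card - 1) - C') ≤ Δ := (cDefect_antitone t ht he hC hCC').trans hD
  rw [prod_eq_pow_mul_cDefect t e hC'.ne']
  exact mul_le_mul_of_nonneg_left (by linarith) (pow_nonneg hC'.le _)

/-! ## (RES0′) with weakened positivity, with a shifted constant, with the leaf-leaf constant -/

/-- **`res0_of_cappedPendant` with the positivity hypothesis weakened** to `0 ≤ α₀₀` and `0 < b_Ȳ = (1−s)α₀₀ + sα₀₁`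
(the floor the capped pendant lemma divides by); otherwise verbatim. [this work] -/
theorem res0_of_cappedPendant₀ [DecidableEq κ] {τ σ s α00 α01 α11 : ℝ} (hσ0 : 0 ≤ σ)
    (hσ1 : σ ≤ 1) (hs0 : 0 ≤ s) (hs1 : s ≤ 1) (hα0 : 0 ≤ α00) (hb : 0 < (1 - s) * α00 + s * α01)
    (h01 : α00 ≤ α01) (h11 : α01 ≤ α11)
    (hCPL : CappedPendant σ τ ((1 - s) * α00 + s * α01) (s * α11 + (1 - s) * α00) (s + (1 - s) * α00))
    (S : Finset κ) (hS : S.Nonempty) (y k gc h : κ → ℝ)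
    (hy : ∀ j ∈ S, α00 ≤ y j) (hy1 : ∀ j ∈ S, y j ≤ 1) (hk : ∀ j ∈ S, α01 ≤ k j) (hk1 : ∀ j ∈ S, k j ≤ 1)
    (hg : ∀ j ∈ S, α01 ≤ gc j) (hgk : ∀ j ∈ S, gc j ≤ k j) (hgh : ∀ j ∈ S, gc j ≤ h j) (hh : ∀ j ∈ S, α11 ≤ h j)
    (hh1 : ∀ j ∈ S, h j ≤ 1)
    (hBY : ∏ j ∈ S, ((1 - s) * y j + s * k j) ≤ ((1 - s) * α00 + s * α01) ^ (S.card - 1))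
    (hBh : ∏ j ∈ S, h j ≤ α11 ^ (S.card - 1))
    (hBH : ∏ j ∈ S, ((1 - σ) * gc j + σ * h j) ≤ ((1 - σ) * α01 + σ * α11) ^ (S.card - 1)) :
    ∏ j ∈ S, (τ * σ + (1 - τ) * (1 - s) * α00 + τ * (1 - σ) * ((1 - s) * y j + s * k j) +
        s * (1 - τ) * ((1 - σ) * gc j + σ * h j)) ≤
      (τ * σ + (1 - τ) * (1 - s) * α00 + τ * (1 - σ) * ((1 - s) * α00 + s * α01) +
        s * (1 - τ) * ((1 - σ) * α01 + σ * α11)) ^ (S.card - 1) *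
        (τ * σ + (1 - τ) * (1 - s) * α00 + τ * (1 - σ) + s * (1 - τ)) := by
  classical
  have hs' : 0 ≤ 1 - s := sub_nonneg.2 hs1
  have hσ' : 0 ≤ 1 - σ := sub_nonneg.2 hσ1
  have hα01 : 0 < α01 := by
    by_contra hneg
    push Not at hneg
    have h1 : (1 - s) * α00 ≤ (1 - s) * α01 := mul_le_mul_of_nonneg_left h01 hs'
    nlinarith [mul_nonneg hs' hα0]
  have hα11 : 0 < α11 := hα01.trans_le h11
  set e := S.equivFin with he
  have mem : ∀ i : Fin S.card, ((e.symm i : S) : κ) ∈ S := fun i => (e.symm i).2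
  set u : Fin S.card → ℝ := fun i => (1 - s) * y ((e.symm i : S) : κ) + s * k ((e.symm i : S) : κ) with hu
  set vv : Fin S.card → ℝ := fun i => s * h ((e.symm i : S) : κ) + (1 - s) * α00 with hvv
  set m : Fin S.card → ℝ := fun i => s * gc ((e.symm i : S) : κ) + (1 - s) * α00 with hm
  set b : ℝ := (1 - s) * α00 + s * α01 with hbdef
  set β : ℝ := s * α11 + (1 - s) * α00 with hβ
  set V : ℝ := s + (1 - s) * α00 with hV
  have hbH : 0 < (1 - σ) * α01 + σ * α11 := by nlinarith [mul_nonneg hσ0 (sub_nonneg.2 h11)]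
  have hBvv : ∏ i, vv i ≤ β ^ (S.card - 1) * V := by
    have h1 := prod_wavg_le hs0 hs1 hα0 hα11 S hS h hh hBh
    have h2 : ∏ i, vv i = ∏ j ∈ S, (s * h j + (1 - s) * α00) := by
      rw [hvv, ← prod_eq_prod_fin_equiv S (fun j => s * h j + (1 - s) * α00)]
    rw [h2, hβ, hV]; exact h1
  have hBg : ∏ i, ((1 - σ) * m i + σ * vv i) ≤ ((1 - σ) * b + σ * β) ^ (S.card - 1) * V := by
    have h1 := prod_wavg_le hs0 hs1 hα0 hbH S hS (fun j => (1 - σ) * gc j + σ * h j)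
      (fun j hj => by nlinarith [hg j hj, hh j hj]) hBH
    have h2 : ∏ i, ((1 - σ) * m i + σ * vv i) = ∏ j ∈ S, (s * ((1 - σ) * gc j + σ * h j) + (1 - s) * α00) := by
      rw [hm, hvv, prod_eq_prod_fin_equiv S (fun j => s * ((1 - σ) * gc j + σ * h j) + (1 - s) * α00)]
      exact Fintype.prod_congr _ _ (fun i => by ring)
    have h3 : s * ((1 - σ) * α01 + σ * α11) + (1 - s) * α00 = (1 - σ) * b + σ * β := by rw [hbdef, hβ]; ring
    rw [h2, ← h3, hV]; exact h1
  have hBu : ∏ i, u i ≤ b ^ (S.card - 1) := by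
    rw [hu, hbdef, ← prod_eq_prod_fin_equiv S (fun j => (1 - s) * y j + s * k j)]; exact hBY
  have key := hCPL S.card u vv m
    (fun i => by show b ≤ u i; rw [hbdef, hu]; nlinarith [hy _ (mem i), hk _ (mem i)])
    (fun i => by show u i ≤ 1; rw [hu]; nlinarith [hy1 _ (mem i), hk1 _ (mem i)])
    (fun i => by show β ≤ vv i; rw [hβ, hvv]; nlinarith [hh _ (mem i)])
    (fun i => by show vv i ≤ V; rw [hV, hvv]; nlinarith [hh1 _ (mem i)])
    (fun i => by show b ≤ m i; rw [hbdef, hm]; nlinarith [hg _ (mem i)])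
    (fun i => by show m i ≤ u i; rw [hm, hu]; nlinarith [hgk _ (mem i), hy _ (mem i)])
    (fun i => by show m i ≤ vv i; rw [hm, hvv]; nlinarith [hgh _ (mem i)])
    hBu hBvv hBg
  have e1 : ∏ j ∈ S, (τ * σ + (1 - τ) * (1 - s) * α00 + τ * (1 - σ) * ((1 - s) * y j + s * k j) +
        s * (1 - τ) * ((1 - σ) * gc j + σ * h j)) =
      ∏ i : Fin S.card, (σ * τ + σ * (1 - τ) * vv i + (1 - σ) * τ * u i + (1 - σ) * (1 - τ) * m i) := by
    rw [prod_eq_prod_fin_equiv S]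
    refine Fintype.prod_congr _ _ (fun i => ?_)
    rw [hu, hvv, hm]; ring
  rw [e1]
  refine key.trans (le_of_eq ?_)
  rw [hbdef, hβ, hV]; ring

/-- **(RES0′) FOR ALL `n` WITH A SHIFTED CONSTANT.**  For every `δ ≥ 0`, coins `τ, σ, s ∈ [0,1]`, floors
`0 ≤ α₀₀ ≤ α₀₁ ≤ α₁₁` with `0 < b_Ȳ = (1−s)α₀₀ + sα₀₁`, and every admissible family (hypotheses of `res0_all`):
`∏_S (c₀ + δ + τ(1−σ)Ȳ_j + s(1−τ)H_j) ≤ (c₀ + δ + τ(1−σ)b_Ȳ + s(1−τ)b_H)^(|S|−1)·(c₀ + δ + τ(1−σ) + s(1−τ))`,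
`c₀ = τσ + (1−τ)(1−s)α₀₀`.  (`res0_all` at `δ = 0`, then `prod_shift_le`.) [this work] -/
theorem res0_shift [DecidableEq κ] {τ σ s α00 α01 α11 δ : ℝ} (hτ0 : 0 ≤ τ) (hτ1 : τ ≤ 1) (hσ0 : 0 ≤ σ)
    (hσ1 : σ ≤ 1) (hs0 : 0 ≤ s) (hs1 : s ≤ 1) (hα0 : 0 ≤ α00) (hb : 0 < (1 - s) * α00 + s * α01)
    (h01 : α00 ≤ α01) (h11 : α01 ≤ α11) (hδ : 0 ≤ δ)
    (S : Finset κ) (hS : S.Nonempty) (y k gc h : κ → ℝ)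
    (hy : ∀ j ∈ S, α00 ≤ y j) (hy1 : ∀ j ∈ S, y j ≤ 1) (hk : ∀ j ∈ S, α01 ≤ k j) (hk1 : ∀ j ∈ S, k j ≤ 1)
    (hg : ∀ j ∈ S, α01 ≤ gc j) (hgk : ∀ j ∈ S, gc j ≤ k j) (hgh : ∀ j ∈ S, gc j ≤ h j) (hh : ∀ j ∈ S, α11 ≤ h j)
    (hh1 : ∀ j ∈ S, h j ≤ 1)
    (hBY : ∏ j ∈ S, ((1 - s) * y j + s * k j) ≤ ((1 - s) * α00 + s * α01) ^ (S.card - 1))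
    (hBh : ∏ j ∈ S, h j ≤ α11 ^ (S.card - 1))
    (hBH : ∏ j ∈ S, ((1 - σ) * gc j + σ * h j) ≤ ((1 - σ) * α01 + σ * α11) ^ (S.card - 1)) :
    ∏ j ∈ S, (τ * σ + (1 - τ) * (1 - s) * α00 + δ + τ * (1 - σ) * ((1 - s) * y j + s * k j) +
        s * (1 - τ) * ((1 - σ) * gc j + σ * h j)) ≤
      (τ * σ + (1 - τ) * (1 - s) * α00 + δ + τ * (1 - σ) * ((1 - s) * α00 + s * α01) +
        s * (1 - τ) * ((1 - σ) * α01 + σ * α11)) ^ (S.card - 1) *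
        (τ * σ + (1 - τ) * (1 - s) * α00 + δ + τ * (1 - σ) + s * (1 - τ)) := by
  classical
  obtain ⟨j₀, hj₀⟩ := hS
  have hα11le : α11 ≤ 1 := (hh j₀ hj₀).trans (hh1 j₀ hj₀)
  have hs' : 0 ≤ 1 - s := sub_nonneg.2 hs1
  have hσ' : 0 ≤ 1 - σ := sub_nonneg.2 hσ1
  have hτ' : 0 ≤ 1 - τ := sub_nonneg.2 hτ1
  have hbβ : (1 - s) * α00 + s * α01 ≤ s * α11 + (1 - s) * α00 := by nlinarith [mul_le_mul_of_nonneg_left h11 hs0]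
  have hβ1 : s * α11 + (1 - s) * α00 ≤ 1 := by nlinarith [h01.trans (h11.trans hα11le)]
  have base := res0_of_cappedPendant₀ hσ0 hσ1 hs0 hs1 hα0 hb h01 h11
    (cappedPendant_holds hb hbβ hβ1 hσ0 hσ1 hτ0 hτ1) S ⟨j₀, hj₀⟩ y k gc h hy hy1 hk hk1 hg hgk hgh hh hh1 hBY hBh hBH
  -- normalised form: constant `C = g*`, excesses `e_j = G_j − g*`, `Δ = a − g*`
  set C : ℝ := τ * σ + (1 - τ) * (1 - s) * α00 + τ * (1 - σ) * ((1 - s) * α00 + s * α01) +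
    s * (1 - τ) * ((1 - σ) * α01 + σ * α11) with hC
  set ex : κ → ℝ := fun j => τ * (1 - σ) * ((1 - s) * y j + s * k j - ((1 - s) * α00 + s * α01)) +
    s * (1 - τ) * ((1 - σ) * gc j + σ * h j - ((1 - σ) * α01 + σ * α11)) with hex
  set Δ : ℝ := τ * (1 - σ) * (1 - ((1 - s) * α00 + s * α01)) + s * (1 - τ) * (1 - ((1 - σ) * α01 + σ * α11)) with hΔ
  have hex0 : ∀ j ∈ S, 0 ≤ ex j := by
    intro j hj
    have h1 : (1 - s) * α00 + s * α01 ≤ (1 - s) * y j + s * k j := by nlinarith [hy j hj, hk j hj]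
    have h2 : (1 - σ) * α01 + σ * α11 ≤ (1 - σ) * gc j + σ * h j := by nlinarith [hg j hj, hh j hj]
    exact add_nonneg (mul_nonneg (mul_nonneg hτ0 hσ') (sub_nonneg.2 h1)) (mul_nonneg (mul_nonneg hs0 hτ') (sub_nonneg.2 h2))
  -- `C ≥ b_Ȳ > 0`
  have hbH : (1 - s) * α00 + s * α01 ≤ (1 - σ) * α01 + σ * α11 := by nlinarith [mul_nonneg hσ0 (sub_nonneg.2 h11)]
  have hb1 : (1 - s) * α00 + s * α01 ≤ 1 := by nlinarith [h01.trans (h11.trans hα11le)]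
  have hCpos : 0 < C := by
    have h1 : (1 - s) * α00 + s * α01 ≤ C := by
      rw [hC]
      nlinarith [mul_nonneg hτ0 hσ0, mul_nonneg (mul_nonneg hτ0 hσ0) (sub_nonneg.2 hb1),
        mul_nonneg (mul_nonneg hs0 hτ') (sub_nonneg.2 hbH), mul_nonneg hτ' hs', mul_nonneg hτ' hs0,
        mul_nonneg (mul_nonneg hτ' hs') (sub_nonneg.2 h01)]
    exact hb.trans_le h1
  have e1 : ∀ j, τ * σ + (1 - τ) * (1 - s) * α00 + τ * (1 - σ) * ((1 - s) * y j + s * k j) +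
      s * (1 - τ) * ((1 - σ) * gc j + σ * h j) = C + ex j := fun j => by rw [hC, hex]; ring
  have e2 : τ * σ + (1 - τ) * (1 - s) * α00 + τ * (1 - σ) + s * (1 - τ) = C + Δ := by rw [hC, hΔ]; ring
  rw [prod_congr rfl fun j _ => e1 j, e2] at base
  have e3 : ∀ j, τ * σ + (1 - τ) * (1 - s) * α00 + δ + τ * (1 - σ) * ((1 - s) * y j + s * k j) +
      s * (1 - τ) * ((1 - σ) * gc j + σ * h j) = (C + δ) + ex j := fun j => by rw [hC, hex]; ring
  have e4 : τ * σ + (1 - τ) * (1 - s) * α00 + δ + τ * (1 - σ) * ((1 - s) * α00 + s * α01) +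
        s * (1 - τ) * ((1 - σ) * α01 + σ * α11) = C + δ := by rw [hC]; ring
  have e5 : τ * σ + (1 - τ) * (1 - s) * α00 + δ + τ * (1 - σ) + s * (1 - τ) = (C + δ) + Δ := by rw [hC, hΔ]; ring
  rw [prod_congr rfl fun j _ => e3 j, e4, e5]
  exact prod_shift_le ⟨j₀, hj₀⟩ hex0 hCpos (le_add_of_nonneg_right hδ) base

/-- **(RES0′) FOR ALL `n` WITH THE LEAF-LEAF CONSTANT** `c₀ = τσ + (1−τ)(1−s)((1−σ)α₀₀ + σα₁₀)`, `α₀₀ ≤ α₁₀`: the section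
relaxation of the relative Lemma A `RLA(A ∪ [z₁u], A ∪ [z₁] ∪ [w])` (block `(z₁,u,w)` with coins `(τ,σ,s)`; frozen cells
`α₀₀ = μ(A|u,w closed)`, `α₁₀ = μ(A|u open, w closed)`; resources `y, k, g, h`).  Floors `0 ≤ α₀₀ ≤ α₀₁ ≤ α₁₁`,
`α₀₀ ≤ α₁₀`, `0 < b_Ȳ`; hypotheses otherwise as in `res0_all`. [this work] -/
theorem res0_leafLeaf [DecidableEq κ] {τ σ s α00 α01 α10 α11 : ℝ} (hτ0 : 0 ≤ τ) (hτ1 : τ ≤ 1) (hσ0 : 0 ≤ σ)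
    (hσ1 : σ ≤ 1) (hs0 : 0 ≤ s) (hs1 : s ≤ 1) (hα0 : 0 ≤ α00) (hb : 0 < (1 - s) * α00 + s * α01)
    (h01 : α00 ≤ α01) (h11 : α01 ≤ α11) (h10 : α00 ≤ α10)
    (S : Finset κ) (hS : S.Nonempty) (y k gc h : κ → ℝ)
    (hy : ∀ j ∈ S, α00 ≤ y j) (hy1 : ∀ j ∈ S, y j ≤ 1) (hk : ∀ j ∈ S, α01 ≤ k j) (hk1 : ∀ j ∈ S, k j ≤ 1)
    (hg : ∀ j ∈ S, α01 ≤ gc j) (hgk : ∀ j ∈ S, gc j ≤ k j) (hgh : ∀ j ∈ S, gc j ≤ h j) (hh : ∀ j ∈ S, α11 ≤ h j)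
    (hh1 : ∀ j ∈ S, h j ≤ 1)
    (hBY : ∏ j ∈ S, ((1 - s) * y j + s * k j) ≤ ((1 - s) * α00 + s * α01) ^ (S.card - 1))
    (hBh : ∏ j ∈ S, h j ≤ α11 ^ (S.card - 1))
    (hBH : ∏ j ∈ S, ((1 - σ) * gc j + σ * h j) ≤ ((1 - σ) * α01 + σ * α11) ^ (S.card - 1)) :
    ∏ j ∈ S, (τ * σ + (1 - τ) * (1 - s) * ((1 - σ) * α00 + σ * α10) + τ * (1 - σ) * ((1 - s) * y j + s * k j) +
        s * (1 - τ) * ((1 - σ) * gc j + σ * h j)) ≤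
      (τ * σ + (1 - τ) * (1 - s) * ((1 - σ) * α00 + σ * α10) + τ * (1 - σ) * ((1 - s) * α00 + s * α01) +
        s * (1 - τ) * ((1 - σ) * α01 + σ * α11)) ^ (S.card - 1) *
        (τ * σ + (1 - τ) * (1 - s) * ((1 - σ) * α00 + σ * α10) + τ * (1 - σ) + s * (1 - τ)) := by
  have hδ : 0 ≤ (1 - τ) * (1 - s) * σ * (α10 - α00) :=
    mul_nonneg (mul_nonneg (mul_nonneg (sub_nonneg.2 hτ1) (sub_nonneg.2 hs1)) hσ0) (sub_nonneg.2 h10)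
  have key := res0_shift hτ0 hτ1 hσ0 hσ1 hs0 hs1 hα0 hb h01 h11 hδ S hS y k gc h hy hy1 hk hk1 hg hgk hgh hh hh1
    hBY hBh hBH
  have e1 : τ * σ + (1 - τ) * (1 - s) * ((1 - σ) * α00 + σ * α10) =
      τ * σ + (1 - τ) * (1 - s) * α00 + (1 - τ) * (1 - s) * σ * (α10 - α00) := by ring
  simp only [e1]
  exact key

end LinkedCurrency

end SafeCalc

end Summit.CriticalPhenomena.PercolationContinuityZ3.Theorems.SunflowerPartition
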